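import Literature.AlgebraicGeometry.Resolution.CompleteLocalDomainNormalization
import Literature.AlgebraicGeometry.Resolution.FormalFibresRegularProofs
import Mathlib.RingTheory.MvPowerSeries.Rename
import Mathlib.RingTheory.Artinian.Module
import HarnessLib

/-!
# The normalization of a complete one-dimensional local domain containing a field is a formal
# power series ring `κ′⟦T⟧` (branch parametrization)

Topic: `Literature/AlgebraicGeometry/Resolution`. Sequel of `CompleteLocalDomainNormalization.lean`
(Kiyek–Vicente, *Resolution of Curve and Surface Singularities*, Ch. II (3.17): the integral closure `W`
of a complete Noetherian local domain `D` of dimension one in `Frac D` is a discrete valuation ring,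
finite over `D`, local) and of `FormalFibresRegularProofs.lean` (Matsumura, *Commutative Ring Theory*,
Thm. 29.7 in equal characteristic: a complete regular local ring containing a field is a formal power
series ring over its residue field, `comp_map_bijective`). Everything here is PROVED; no definitions,
no named facts:

* `isAdicComplete_of_pow_le_of_le` — **change of the ideal of definition** (Matsumura §8, p. 62:
  "An ideal of definition is not uniquely determined; any ideal defining the same topology will do"):
  if `Iᵉ ⊆ J ⊆ I` and `M` is `J`-adically complete then `M` is `I`-adically complete.
* `isAdicComplete_maximalIdeal_of_module_finite` — **a local ring `B` which is a module-finite
  algebra over a complete Noetherian local ring `(A, 𝔪)` is complete** for its own maximal ideal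
  (Matsumura Thm. 8.7: `B` is `𝔪B`-adically complete, `FiniteOverCompleteLocal.lean`; and
  `𝔪_Bᵉ ⊆ 𝔪B ⊆ 𝔪_B` because `B/𝔪B` is an Artinian local ring and `B` is integral over `A` — the
  local case of Thm. 8.15).
* `isAdicComplete_maximalIdeal_integralClosure_of_complete` — hence the normalization `W` of a
  complete one-dimensional Noetherian local domain `D` is a **complete** discrete valuation ring.
* `exists_ringEquiv_powerSeries_of_isDiscreteValuationRing` — **Matsumura Thm. 29.7 for `d = 1`**:
  a complete discrete valuation ring `W` containing a field is `κ⟦T⟧`, `κ` its residue field; precisely,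
  for every uniformizer `ϖ` there is a ring isomorphism `e : κ⟦T⟧ ≃ W` with `e(T) = ϖ` whose
  restriction to the constants is a coefficient field (`residue ∘ e ∘ C = id`). Assembled from the
  tree's coefficient field (`CompleteLocalRings.exists_ringHom_comp_residue_eq_id_of_subring`,
  Matsumura Thm. 28.3 (ii)), substitution homomorphism (`exists_adicEvalHom`) and expansion theorem
  (`comp_map_bijective`), and Mathlib's `MvPowerSeries.renameEquiv` along `Fin 1 ≃ Unit`.
* `exists_ringEquiv_powerSeries_integralClosure_of_complete` — **the branch parametrization**: for a
  complete one-dimensional Noetherian local domain `D` containing a field, `W ≃ κ_W⟦T⟧` with `T ↦` a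
  uniformizer; together with `isLocalHom_algebraMap_integralClosure` and
  `exists_mul_algebraMap_eq_of_mem_integralClosure` (`D → W` injective, local, birational) this is the
  classical parametrization `D ↪ κ′⟦τ⟧` of an (analytically irreducible) algebroid branch;
  `exists_ringEquiv_powerSeries_integralClosure_of_complete'` is the same over a base field `k` given
  as an `Algebra k D` structure, and `exists_branchParametrization_of_complete` packages the
  composite `τ = e⁻¹ ∘ (D → W) : D → κ′⟦T⟧` — injective, a local homomorphism, birational.
* (private `isField_range_of_field` — the image of a field is a subfield, feeding `k₀` from an
  `Algebra k D` structure.)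

## References

* H. Matsumura, *Commutative Ring Theory*, CUP 1986: §8 p. 62 (ideals of definition), Thm. 8.7,
  Thm. 8.15, Thm. 28.3 (ii), Thm. 29.7. [cite: Matsumura1987, Thm. 8.7, Thm. 8.15, Thm. 29.7]
* K. Kiyek, J. L. Vicente, *Resolution of Curve and Surface Singularities in Characteristic Zero*,
  Kluwer 2004, Ch. II (3.17)–(3.18). [cite: KiyekVicente2004, Ch. II (3.17)]
-/

noncomputable section

open IsLocalRing

namespace Literature.AlgebraicGeometry.Resolution

universe u

/-! ## Change of the ideal of definition (Matsumura §8, p. 62) -/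

section IdealOfDefinition

variable {R : Type*} [CommRing R] {M : Type*} [AddCommGroup M] [Module R M]

/-- **Ideals with the same adic topology have the same complete modules** (Matsumura §8, p. 62:
"any ideal defining the same topology will do"): if `Iᵉ ⊆ J ⊆ I` and `M` is `J`-adically complete,
then `M` is `I`-adically complete. (`IᵉⁿM ⊆ JⁿM ⊆ IⁿM`: an `I`-Cauchy sequence has a `J`-Cauchy
subsequence, whose `J`-limit is an `I`-limit.) [cite: Matsumura1987, §8 p. 62] -/
theorem isAdicComplete_of_pow_le_of_le {I J : Ideal R} {e : ℕ} (hIJ : I ^ e ≤ J) (hJI : J ≤ I)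
    [IsAdicComplete J M] : IsAdicComplete I M := by
  have h1 : ∀ n, (I ^ (e * n) • ⊤ : Submodule R M) ≤ J ^ n • ⊤ := fun n =>
    Submodule.smul_mono_left (by rw [pow_mul]; exact Ideal.pow_right_mono hIJ n)
  have h2 : ∀ n, (J ^ n • ⊤ : Submodule R M) ≤ I ^ n • ⊤ := fun n =>
    Submodule.smul_mono_left (Ideal.pow_right_mono hJI n)
  rcases Nat.eq_zero_or_pos e with rfl | he
  · -- `J = ⊤`: a `⊤`-adically separated module is trivial
    have hJ : J = ⊤ := top_le_iff.mp (by simpa using hIJ)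
    subst hJ
    haveI : Subsingleton M := ⟨fun a b => by
      have h := IsHausdorff.haus' (I := (⊤ : Ideal R)) (M := M) (a - b) fun n => by
        rw [Ideal.top_pow, Submodule.top_smul]
        exact SModEq.top
      exact sub_eq_zero.mp h⟩
    infer_instance
  haveI hH : IsHausdorff I M := ⟨fun x hx =>
    IsHausdorff.haus' (I := J) x fun n => (hx (e * n)).mono (h1 n)⟩
  haveI hP : IsPrecomplete I M := ⟨fun {f} hf => by
    obtain ⟨L, hL⟩ := IsPrecomplete.prec' (I := J) (M := M) (f := fun n => f (e * n))
      fun {m n} hmn => (hf (Nat.mul_le_mul_left e hmn)).mono (h1 m)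
    exact ⟨L, fun n =>
      ((hf (Nat.le_mul_of_pos_left n he)).trans ((hL n).mono (h2 n)))⟩⟩
  exact { toIsHausdorff := hH, toIsPrecomplete := hP }

end IdealOfDefinition

/-! ## Finite local algebras over a complete local ring (Matsumura Thm. 8.7, Thm. 8.15) -/

section FiniteLocal

variable (A B : Type u) [CommRing A] [IsLocalRing A] [CommRing B] [IsLocalRing B] [Algebra A B]

/-- For a local ring `B` integral over a local ring `A` (through `algebraMap`, not assumed injective),
`𝔪_A B ⊆ 𝔪_B`: the contraction of `𝔪_B` is a maximal ideal of `A` (Matsumura §9, Lemma 2, p. 66: "If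
`P` is a maximal ideal of `B` then `P ∩ A` is a maximal ideal of `A`", applied to `A/ker → B`).
[cite: Matsumura1987, §9 Lemma 2 (p. 66)] -/
theorem map_maximalIdeal_le_maximalIdeal [Algebra.IsIntegral A B] :
    (maximalIdeal A).map (algebraMap A B) ≤ maximalIdeal B := by
  have hmax : ((maximalIdeal B).comap (algebraMap A B)).IsMaximal :=
    Ideal.isMaximal_comap_of_isIntegral_of_isMaximal _
  rw [Ideal.map_le_iff_le_comap, ← IsLocalRing.eq_maximalIdeal hmax]

/-- For a local ring `B` module-finite over a local ring `(A, 𝔪)`, some power of `𝔪_B` lies in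
`𝔪B`: `B/𝔪B` is a finite-dimensional algebra over the residue field, an Artinian local ring, whose
maximal ideal is nilpotent. [cite: Matsumura1987, Thm. 8.15] -/
theorem exists_maximalIdeal_pow_le_map [Module.Finite A B] :
    ∃ e : ℕ, maximalIdeal B ^ e ≤ (maximalIdeal A).map (algebraMap A B) := by
  haveI : Algebra.IsIntegral A B := Algebra.IsIntegral.of_finite A B
  set J : Ideal B := (maximalIdeal A).map (algebraMap A B) with hJ
  have hJle : J ≤ maximalIdeal B := map_maximalIdeal_le_maximalIdeal A B
  have hJne : J ≠ ⊤ := fun h => (maximalIdeal.isMaximal B).ne_top (top_le_iff.mp (h ▸ hJle))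
  -- `B/J` is an Artinian local ring
  letI : Field (A ⧸ maximalIdeal A) := Ideal.Quotient.field _
  haveI : Module.Finite (A ⧸ maximalIdeal A) (B ⧸ J) :=
    Module.Finite.of_restrictScalars_finite A (A ⧸ maximalIdeal A) (B ⧸ J)
  haveI : IsArtinianRing (B ⧸ J) := IsArtinianRing.of_finite (A ⧸ maximalIdeal A) (B ⧸ J)
  haveI : Nontrivial (B ⧸ J) := Ideal.Quotient.nontrivial_iff.mpr hJne
  haveI : IsLocalRing (B ⧸ J) :=
    IsLocalRing.of_surjective' (Ideal.Quotient.mk J) Ideal.Quotient.mk_surjective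
  -- its maximal ideal is the image of `𝔪_B`, and is nilpotent
  have hmap : (maximalIdeal B).map (Ideal.Quotient.mk J) = maximalIdeal (B ⧸ J) := by
    have hsurj : Function.Surjective (Ideal.Quotient.mk J) := Ideal.Quotient.mk_surjective
    rcases Ideal.map_eq_top_or_isMaximal_of_surjective _ hsurj (maximalIdeal.isMaximal B) with
      h | h
    · exfalso
      have hc := congrArg (Ideal.comap (Ideal.Quotient.mk J)) h
      rw [Ideal.comap_map_of_surjective _ hsurj, Ideal.comap_top, ← RingHom.ker_eq_comap_bot,
        Ideal.mk_ker, sup_eq_left.mpr hJle] at hc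
      exact (maximalIdeal.isMaximal B).ne_top hc
    · exact IsLocalRing.eq_maximalIdeal h
  obtain ⟨e, he⟩ := IsArtinianRing.isNilpotent_jacobson_bot (R := B ⧸ J)
  rw [IsLocalRing.jacobson_eq_maximalIdeal ⊥ bot_ne_top, ← hmap, ← Ideal.map_pow,
    Ideal.zero_eq_bot] at he
  refine ⟨e, fun x hx => ?_⟩
  rw [← Ideal.Quotient.eq_zero_iff_mem, ← Ideal.mem_bot, ← he]
  exact Ideal.mem_map_of_mem _ hx

/-- **A local ring which is module-finite over a complete Noetherian local ring is complete**
(Matsumura, Thm. 8.7: `B` is `𝔪_A B`-adically complete; Thm. 8.15, local case: its topology is the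
`𝔪_B`-adic one, `𝔪_Bᵉ ⊆ 𝔪_A B ⊆ 𝔪_B`). [cite: Matsumura1987, Thm. 8.7 and Thm. 8.15] -/
theorem isAdicComplete_maximalIdeal_of_module_finite [IsNoetherianRing A]
    [IsAdicComplete (maximalIdeal A) A] [Module.Finite A B] :
    IsAdicComplete (maximalIdeal B) B := by
  haveI : Algebra.IsIntegral A B := Algebra.IsIntegral.of_finite A B
  haveI : IsAdicComplete ((maximalIdeal A).map (algebraMap A B)) B :=
    isAdicComplete_map_of_finite A B (maximalIdeal A)
  obtain ⟨e, he⟩ := exists_maximalIdeal_pow_le_map A B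
  exact isAdicComplete_of_pow_le_of_le he (map_maximalIdeal_le_maximalIdeal A B)

end FiniteLocal

/-! ## A complete discrete valuation ring containing a field is `κ⟦T⟧` (Matsumura Thm. 29.7, `d = 1`) -/

section DVR

/-- The image of a field under a ring homomorphism into a nontrivial ring is a subring which is a
field (bookkeeping: produces the subfield `k₀` of the statements below from an algebra structure
over a field). [folklore] -/
private theorem isField_range_of_field {k : Type*} [Field k] {S : Type*} [CommRing S] [Nontrivial S]
    (φ : k →+* S) : IsField φ.range :=
  MulEquiv.isField (Field.toIsField k)
    (RingEquiv.ofBijective φ.rangeRestrict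
      ⟨fun _ _ h => φ.injective (congrArg Subtype.val h), φ.rangeRestrict_surjective⟩).symm.toMulEquiv

variable (W : Type u) [CommRing W] [IsDomain W] [IsDiscreteValuationRing W]

/-- **A complete discrete valuation ring containing a field is a formal power series ring in one
variable over its residue field** (Matsumura, Thm. 29.7, equal characteristic, the case `d = 1`:
"if `x₁, …, xₙ` is a regular system of parameters of `A` then `A = R⟦x₁, …, xₙ⟧ ≅ R⟦X₁, …, Xₙ⟧`",
`R` a coefficient field). For every uniformizer `ϖ` of `W` there is a ring isomorphism
`e : κ⟦T⟧ ≃ W`, `κ = W/𝔪_W`, with `e(T) = ϖ` and `residue (e (C c)) = c` (the constants form a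
coefficient field). [cite: Matsumura1987, Thm. 29.7] -/
theorem exists_ringEquiv_powerSeries_of_isDiscreteValuationRing [IsAdicComplete (maximalIdeal W) W]
    (k₀ : Subring W) (hk₀ : IsField k₀) (ϖ : W) (hϖ : Irreducible ϖ) :
    ∃ e : PowerSeries (ResidueField W) ≃+* W,
      e PowerSeries.X = ϖ ∧ ∀ c, residue W (e (PowerSeries.C c)) = c := by
  classical
  -- a coefficient field
  obtain ⟨σ, hσ⟩ :=
    Literature.RingTheory.CompleteLocalRings.exists_ringHom_comp_residue_eq_id_of_subring W k₀ hk₀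
  -- the regular system of parameters `(ϖ)`
  have hmax : maximalIdeal W = Ideal.span {ϖ} :=
    (IsDiscreteValuationRing.irreducible_iff_uniformizer ϖ).mp hϖ
  let x : Fin 1 → W := fun _ => ϖ
  have hrange : Set.range x = {ϖ} := by
    ext w
    simp only [Set.mem_range, Set.mem_singleton_iff, x]
    exact ⟨fun ⟨_, h⟩ => h.symm, fun h => ⟨0, h.symm⟩⟩
  have hx : Ideal.span (Set.range x) = maximalIdeal W := by rw [hrange, hmax]
  have hxm : ∀ i, x i ∈ maximalIdeal W := fun i => hx ▸ Ideal.subset_span ⟨i, rfl⟩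
  have hd : (maximalIdeal W).spanFinrank = 1 :=
    (Submodule.spanFinrank_eq_one_iff _).mpr
      ⟨inferInstance, IsDiscreteValuationRing.not_a_field W⟩
  -- the substitution homomorphism and the expansion theorem
  obtain ⟨Φ, hΦ₁, hΦ₂⟩ := exists_adicEvalHom (maximalIdeal W) x hxm
  have hbij := comp_map_bijective σ hσ hd x hx Φ hΦ₁ hΦ₂
  let e₁ : MvPowerSeries (Fin 1) (ResidueField W) ≃+* W := RingEquiv.ofBijective _ hbij
  have he₁X : e₁ (MvPowerSeries.X 0) = ϖ := by
    change Φ (MvPowerSeries.map σ (MvPowerSeries.X 0)) = ϖ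
    rw [MvPowerSeries.map_X, ← MvPolynomial.coe_X, hΦ₁, MvPolynomial.eval_X]
  have he₁C : ∀ c, e₁ (MvPowerSeries.C c) = σ c := fun c => by
    change Φ (MvPowerSeries.map σ (MvPowerSeries.C c)) = σ c
    rw [MvPowerSeries.map_C, ← MvPolynomial.coe_C, hΦ₁, MvPolynomial.eval_C]
  -- one variable: `κ⟦T⟧ = κ⟦X_s : s ∈ Unit⟧ ≃ κ⟦X_s : s ∈ Fin 1⟧`
  let e₀ : PowerSeries (ResidueField W) ≃+* MvPowerSeries (Fin 1) (ResidueField W) :=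
    (MvPowerSeries.renameEquiv (ResidueField W) finOneEquiv.symm).toRingEquiv
  have he₀ : ∀ p, e₀ p = MvPowerSeries.rename finOneEquiv.symm p := fun _ => rfl
  have he₀X : e₀ PowerSeries.X = MvPowerSeries.X 0 := by
    rw [he₀, show (PowerSeries.X : PowerSeries (ResidueField W)) = MvPowerSeries.X () from rfl,
      MvPowerSeries.rename_X]
    rfl
  have he₀C : ∀ c, e₀ (PowerSeries.C c) = MvPowerSeries.C c := fun c => by
    rw [he₀, show (PowerSeries.C c : PowerSeries (ResidueField W)) = MvPowerSeries.C c from rfl,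
      MvPowerSeries.rename_C]
  refine ⟨e₀.trans e₁, ?_, fun c => ?_⟩
  · rw [RingEquiv.trans_apply, he₀X, he₁X]
  · rw [RingEquiv.trans_apply, he₀C, he₁C, hσ]

end DVR

/-! ## The normalization of a complete one-dimensional local domain -/

section Normalization

variable (D : Type u) [CommRing D] [IsDomain D] [IsLocalRing D] [IsNoetherianRing D]
  [IsAdicComplete (maximalIdeal D) D]

/-- **The normalization of a complete one-dimensional Noetherian local domain is complete**: the
discrete valuation ring `W` = integral closure of `D` in `Frac D` (K–V II (3.17) (3); a local ring,
module-finite over the complete local ring `D`) is `𝔪_W`-adically complete.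
[cite: KiyekVicente2004, Ch. II (3.17)] -/
theorem isAdicComplete_maximalIdeal_integralClosure_of_complete (hdim : ringKrullDim D = 1) :
    haveI := isLocalRing_integralClosure_of_complete D hdim
    IsAdicComplete (maximalIdeal (integralClosure D (FractionRing D)))
      (integralClosure D (FractionRing D)) := by
  haveI := module_finite_integralClosure_of_complete D hdim
  haveI := isLocalRing_integralClosure_of_complete D hdim
  exact isAdicComplete_maximalIdeal_of_module_finite D (integralClosure D (FractionRing D))

/-- **Branch parametrization.** Let `D` be a complete one-dimensional Noetherian local domain
containing a field `k₀`, and `W` its integral closure in `Frac D` — a complete discrete valuation ring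
(K–V II (3.17)). Then `W ≃ κ_W⟦T⟧` (Matsumura Thm. 29.7 with `d = 1`): there are a uniformizer `ϖ`
of `W` and a ring isomorphism `e : κ_W⟦T⟧ ≃ W` with `e(T) = ϖ` and `residue (e (C c)) = c`. With
`D → W` injective, local and birational (`isLocalHom_algebraMap_integralClosure`,
`exists_mul_algebraMap_eq_of_mem_integralClosure`) this is the parametrization `D ↪ κ′⟦τ⟧` of the
branch `Spec D`. [cite: KiyekVicente2004, Ch. II (3.17); Matsumura1987, Thm. 29.7] -/
theorem exists_ringEquiv_powerSeries_integralClosure_of_complete (k₀ : Subring D) (hk₀ : IsField k₀)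
    (hdim : ringKrullDim D = 1) :
    haveI := isDiscreteValuationRing_integralClosure_of_complete D hdim
    ∃ (ϖ : integralClosure D (FractionRing D))
      (e : PowerSeries (ResidueField (integralClosure D (FractionRing D))) ≃+*
        integralClosure D (FractionRing D)),
      Irreducible ϖ ∧ e PowerSeries.X = ϖ ∧
        ∀ c, residue (integralClosure D (FractionRing D)) (e (PowerSeries.C c)) = c := by
  set W := integralClosure D (FractionRing D) with hW
  haveI hdvr := isDiscreteValuationRing_integralClosure_of_complete D hdim
  haveI : IsAdicComplete (maximalIdeal W) W :=
    isAdicComplete_maximalIdeal_integralClosure_of_complete D hdim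
  -- the field `k₀` inside `W`
  have hinj : Function.Injective (algebraMap D W) := fun _ _ h => by
    have := congrArg (fun w : W => (w : FractionRing D)) h
    exact IsFractionRing.injective D (FractionRing D) this
  let k₁ : Subring W := k₀.map (algebraMap D W)
  have hk₁ : IsField k₁ :=
    MulEquiv.isField hk₀ (k₀.equivMapOfInjective (algebraMap D W) hinj).symm.toMulEquiv
  obtain ⟨ϖ, hϖ⟩ := IsDiscreteValuationRing.exists_irreducible W
  obtain ⟨e, heX, heC⟩ := exists_ringEquiv_powerSeries_of_isDiscreteValuationRing W k₁ hk₁ ϖ hϖ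
  exact ⟨ϖ, e, hϖ, heX, heC⟩

/-- The same over a base FIELD `k` given as an algebra structure (`k₀ :=` the image of `k`).
[cite: KiyekVicente2004, Ch. II (3.17); Matsumura1987, Thm. 29.7] -/
theorem exists_ringEquiv_powerSeries_integralClosure_of_complete' (k : Type*) [Field k]
    [Algebra k D] (hdim : ringKrullDim D = 1) :
    haveI := isDiscreteValuationRing_integralClosure_of_complete D hdim
    ∃ (ϖ : integralClosure D (FractionRing D))
      (e : PowerSeries (ResidueField (integralClosure D (FractionRing D))) ≃+*
        integralClosure D (FractionRing D)),
      Irreducible ϖ ∧ e PowerSeries.X = ϖ ∧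
        ∀ c, residue (integralClosure D (FractionRing D)) (e (PowerSeries.C c)) = c :=
  exists_ringEquiv_powerSeries_integralClosure_of_complete D (algebraMap k D).range
    (isField_range_of_field (algebraMap k D)) hdim

/-- **The parametrization `τ : D ↪ κ′⟦T⟧` of the branch**: for a complete one-dimensional
Noetherian local domain `D` containing a field there are a ring isomorphism `e : κ′⟦T⟧ ≃ W` onto the
normalization `W` of `D` (`κ′` its residue field, `e(T)` a uniformizer) such that the composite
`τ = e⁻¹ ∘ (D → W) : D → κ′⟦T⟧` is an INJECTIVE LOCAL ring homomorphism — so every `0 ≠ f ∈ D` has a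
finite `T`-order and a leading coefficient along the branch, positive order exactly on `𝔪_D` — and
every power series becomes a quotient of two elements of `τ(D)` (birationality).
[cite: KiyekVicente2004, Ch. II (3.17); Matsumura1987, Thm. 29.7] -/
theorem exists_branchParametrization_of_complete (k₀ : Subring D) (hk₀ : IsField k₀)
    (hdim : ringKrullDim D = 1) :
    haveI := isDiscreteValuationRing_integralClosure_of_complete D hdim
    ∃ (e : PowerSeries (ResidueField (integralClosure D (FractionRing D))) ≃+*
        integralClosure D (FractionRing D)),
      Irreducible (e PowerSeries.X) ∧
      (∀ c, residue (integralClosure D (FractionRing D)) (e (PowerSeries.C c)) = c) ∧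
      Function.Injective
        (e.symm.toRingHom.comp (algebraMap D (integralClosure D (FractionRing D)))) ∧
      IsLocalHom (e.symm.toRingHom.comp (algebraMap D (integralClosure D (FractionRing D)))) ∧
      ∀ g : PowerSeries (ResidueField (integralClosure D (FractionRing D))), ∃ a b : D, b ≠ 0 ∧
        g * e.symm (algebraMap D _ b) = e.symm (algebraMap D _ a) := by
  set W := integralClosure D (FractionRing D) with hW
  haveI hdvr := isDiscreteValuationRing_integralClosure_of_complete D hdim
  obtain ⟨ϖ, e, hϖ, heX, heC⟩ :=
    exists_ringEquiv_powerSeries_integralClosure_of_complete D k₀ hk₀ hdim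
  have hinj : Function.Injective (algebraMap D W) := fun _ _ h => by
    have := congrArg (fun w : W => (w : FractionRing D)) h
    exact IsFractionRing.injective D (FractionRing D) this
  haveI : IsLocalHom (algebraMap D W) := isLocalHom_algebraMap_integralClosure D
  haveI : IsLocalHom e.symm.toRingHom := ⟨fun w hw => by
    simpa using hw.map e.toRingHom⟩
  refine ⟨e, heX ▸ hϖ, heC, e.symm.injective.comp hinj, RingHom.isLocalHom_comp _ _, fun g => ?_⟩
  obtain ⟨a, b, hb, hab⟩ := exists_mul_algebraMap_eq_of_mem_integralClosure D (e g)
  refine ⟨a, b, fun h => hb (by rw [h, map_zero]), e.injective ?_⟩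
  rw [map_mul, RingEquiv.apply_symm_apply, RingEquiv.apply_symm_apply]
  exact hab

end Normalization

end Literature.AlgebraicGeometry.Resolution

end
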